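import Summits.Ventures.YMGap.YM3IR.BalabanSUN
import Summits.Ventures.YMGap.RobustBall.TorusRowsSU3StarCertifiedDim3
import HarnessLib

/-!
# YM3IR / BalabanCeilingsSU3Certified — the §Y4 sentence for `SU(3)` on engine-2's CERTIFIED-STAR row (Wilson `β_W = 33/40`,
GIVEN the cell's one-link inputs H1/H2), with the counted crossover (theorems only; no new conjecture name)

HONEST FRAMING (cell pub-ymgap, track Y4 / YM3-IR, seat ym3ir-theory-1, gen 10; follow-up to `YM3IR/BalabanSU3.lean` and
`YM3IR/BalabanCeilingsSU3.lean`, written once engine-2's `RobustBall/TorusRowsSU3StarCertifiedDim3.lean` was ACCEPTED).  This file claims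
NO summit, NO mass gap and NO part of Bałaban's theorems.  It is kernel-checked BOOKKEEPING:
`BalabanSUN.massGap3Cofinal_suN_balaban_of_irConjecture3` at `N = 3` with track Y2's input (`ClusterDomainClustering`) DISCHARGED BY NAME
by engine-2's row `RobustBall.su3_clusterDomainClustering_dim3_certifiedStar_thirtyThreeFortieths hP hV r` — ds-2's robust vertex-star door
run on engine-2's CERTIFIED one-link modulus `K = 7/5`, GIVEN H1 `OneLinkPoincareSUN 3 (3/5) (4/5)` and H2 `OneLinkVarianceBound 3 (11/30)
(49/20)` (the cell's `SU(3)` one-link hypotheses: certified computations, class C-iv, DISPLAYED, not proved here) — receiving up to tree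
coupling `11/40` = Wilson `β_W = 33/40` on the ball `ClusterDomainFR (11/500) (11/1000) r`, versus `1/12` (Wilson `1/4`) for the
H1/H2-conditional sentence of `BalabanSU3` and `1/9` (Wilson `1/3`) for the hypothesis-free star sentence of `BalabanCeilingsSU3`.
Lattice statements only; no continuum limit, no Millennium claim; no axiom, no `sorry`, no `def`; `0` compute.

THE HYPOTHESIS LIST, VERBATIM (`massGap3Cofinal_su3_balaban_certifiedStar_of_pair_of_irConjecture3`): `BalabanUV3 mk` — IN PRINT (Bałaban,
CMP 102 (1985), Thm 1 p. 257 + Thm 2 p. 272), logically IDLE in the arrow (theory-2 F2; R196); `Nonempty (Family L eps0)` — print's clauses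
at one coupling (p. 256 L15–18); `0 < C_b`, `0 < κ`; H1, H2 — CERTIFIED (two engines), displayed; `IRConjecture3 (ballOfRobustBallFR 3
(11/500) (11/1000) r (11/40)) suFrobDist (fundamentalRep (Fin 3)) (balabanCouplings L (suGroupModel 3) eps0) C_b κ` — the ONE CONJECTURE of
record (theory-2, `YM3IR/Statement.lean`; NOT in print).  LABEL OF RECORD (R196, verbatim): a typed INTERFACE / dictionary, NOT a
reduction — with existential `(C_b, κ)` the free-family conjecture is target-equivalent on every receiving ball in the tree (theory-2,
`YM3IR/ForestWitness.lean`, `YM3IR/ForestWitnessSUN.lean`: the forest witness enters any ball containing product Haar).  CONCLUSION: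
`MassGap3Cofinal (balabanCouplings L (suGroupModel 3) eps0) suFrobDist (fundamentalRep (Fin 3))`.

COUNTED CROSSOVER (PROVED arithmetic, tree units `β = β_W/3`): below the ceiling `11/40` after `K + M'` steps iff `L^{M'} ≥ 40/(33·γ₀²)`
(`su3_betaTree_div_pow_le_11_40_iff`); since `γ₀² ≤ 1` this still forces `M' ≥ 1` (`su3_row_certifiedStar_crossover_pos`) — the highest
certified `SU(3)` receiving row does not make the fronts meet — vs `3/γ₀²` at `1/9`, `4/γ₀²` at `1/12`, `40/(9γ₀²)` on p1's every-`N` row.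

WHY THIS IS USEFUL (one sentence).  It records, by name and kernel-checked, how far the CERTIFIED strong-coupling receiving end for the
physical colour group reaches today (Wilson `β_W = 33/40`, hypotheses H1/H2 displayed) and what that leaves for the crossover: at least one
block-RG step at `O(1)` effective coupling for every admissible `γ₀`.

References: T. Bałaban, CMP 102 (1985) 255–275, p. 256 L15–18, (5) p. 256, Thm 1 p. 257, Thm 2 p. 272 [cite: Balaban1985UV3].
-/

noncomputable section

open MeasureTheory
open Literature.MathematicalPhysics.QuantumLattice Literature.MathematicalPhysics.QuantumFieldTheory
open Balaban1985CMP102 Balaban1985CMP102.Setting Balaban1985CMP102.Theorems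
open Literature.MathematicalPhysics.QuantumFieldTheory.Balaban1983to89 (GaugeGroup HaarData)
open Summit.QuantumFields.Balaban3D.Carriers (suGroupModel)
open Summit.QuantumFields.BalabanUV.InfraRed.StrongCouplingPoincareDoorSUN (OneLinkPoincareSUN)
open Summit.QuantumFields.BalabanUV.InfraRed.StrongCouplingVarianceDoorSUN (OneLinkVarianceBound)

namespace Summit.Ventures.YMGap.YM3IR

open CarrierBridge

/-- **`SU(3)` lattice YM₃ mass gap on Bałaban's coupling set, receiving at Wilson `β_W = 33/40` GIVEN H1/H2 (PROVED bookkeeping).**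
engine-2's certified-star row `RobustBall.su3_clusterDomainClustering_dim3_certifiedStar_thirtyThreeFortieths hP hV r` BY NAME (tree ceiling
`11/40`, ball `ClusterDomainFR (11/500) (11/1000) r`, some rate `m > 0`).  Besides the displayed certified inputs H1/H2, EXACTLY ONE hypothesis is
neither in print nor certified: `IRConjecture3` (label of record R196: a dictionary, not a reduction; `BalabanUV3 mk` is logically idle).
[cite: Balaban1985UV3, Thm 1 p.257; Thm 2 p.272] -/
theorem massGap3Cofinal_su3_balaban_certifiedStar_of_pair_of_irConjecture3 {L : ℕ} {mk : Construction L} {eps0 : ℝ → ℝ}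
    (hfam : Nonempty (Family L eps0)) (r : ℕ) {C_b κ : ℝ} (hC : 0 < C_b) (hκ : 0 < κ) (hUV : BalabanUV3 mk)
    (hP : OneLinkPoincareSUN 3 (3 / 5) (4 / 5)) (hV : OneLinkVarianceBound 3 (11 / 30) (49 / 20))
    (hIR : IRConjecture3 (ballOfRobustBallFR 3 (11 / 500) (11 / 1000) r (11 / 40)) suFrobDist (fundamentalRep (Fin 3))
      (balabanCouplings L (suGroupModel 3) eps0) C_b κ) :
    MassGap3Cofinal (balabanCouplings L (suGroupModel 3) eps0) suFrobDist
      (fundamentalRep (Fin 3) : RobustBall.SUN 3 →* Matrix (Fin 3) (Fin 3) ℂ) := by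
  obtain ⟨m, hm, hRB, -⟩ := RobustBall.su3_clusterDomainClustering_dim3_certifiedStar_thirtyThreeFortieths hP hV r
  exact massGap3Cofinal_suN_balaban_of_irConjecture3 hfam hC hκ hm hUV hRB hIR

/-- **In PRINT'S quantifier order at `β_W = 33/40` (PROVED bookkeeping):** `∃ eps0` first (print, p. 256 L15–18), then for every `r`,
`C_b`, `κ`: `Nonempty (Family L eps0) → H1 → H2 → IRConjecture3` on the row's ball (label of record R196: a dictionary, not a reduction)
`⟹ MassGap3Cofinal`. [cite: Balaban1985UV3, p.256 L15–18; Thm 2 p.272] -/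
theorem massGap3Cofinal_su3_balaban_certifiedStar_printedOrder_of_pair_of_irConjecture3 {L : ℕ} (mk : Construction L)
    (hUV : BalabanUV3 mk) :
    ∃ eps0 : ℝ → ℝ, (∀ g : ℝ, 0 < g → 0 < eps0 g) ∧
      (∀ S : Family L eps0, ∀ k, k ≤ S.1.K → (mk (RobustBall.SUN 3) (suGroupModel 3) S.1).ineq41_47 k) ∧
      ∀ (r : ℕ) (C_b κ : ℝ), 0 < C_b → 0 < κ → Nonempty (Family L eps0) →
        OneLinkPoincareSUN 3 (3 / 5) (4 / 5) → OneLinkVarianceBound 3 (11 / 30) (49 / 20) →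
        IRConjecture3 (ballOfRobustBallFR 3 (11 / 500) (11 / 1000) r (11 / 40)) suFrobDist (fundamentalRep (Fin 3))
          (balabanCouplings L (suGroupModel 3) eps0) C_b κ →
          MassGap3Cofinal (balabanCouplings L (suGroupModel 3) eps0) suFrobDist
            (fundamentalRep (Fin 3) : RobustBall.SUN 3 →* Matrix (Fin 3) (Fin 3) ℂ) := by
  obtain ⟨eps0, hpos, h2, h⟩ := massGap3Cofinal_suN_balaban_printedOrder_of_irConjecture3 (N := 3) mk hUV
  refine ⟨eps0, hpos, h2, fun r C_b κ hC hκ hfam hP hV hIR => ?_⟩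
  obtain ⟨m, hm, hRB, -⟩ := RobustBall.su3_clusterDomainClustering_dim3_certifiedStar_thirtyThreeFortieths hP hV r
  exact h (ballOfRobustBallFR 3 (11 / 500) (11 / 1000) r (11 / 40)) C_b κ m hC hκ hm hfam hRB hIR

/-- **`SU(3)` at the certified-star ceiling `β⋆ = 11/40` (`β_W = 33/40`; PROVED arithmetic):** a member's coupling after `K + M'` steps
is below `11/40` iff `L^{M'} ≥ 40/(33·γ₀²)`. [cite: Balaban1985UV3, (5) p.256] -/
theorem su3_betaTree_div_pow_le_11_40_iff {L : ℕ} (S : Scales L) (M' : ℕ) :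
    betaTree (suGroupModel 3) S / (L : ℝ) ^ (S.K + M') ≤ 11 / 40 ↔ 40 / (33 * Dictionary.gammaSq S) ≤ (L : ℝ) ^ M' := by
  rw [suN_betaTree_div_pow_le_iff S M' (by norm_num : (0 : ℝ) < 11 / 40)]
  have hγ : 0 < Dictionary.gammaSq S := Dictionary.gammaSq_pos S
  have e : (((3 : ℕ) : ℝ) * Dictionary.gammaSq S * (11 / 40))⁻¹ = 40 / (33 * Dictionary.gammaSq S) := by
    push_cast
    field_simp
    ring
  rw [e]

/-- Hence at `β⋆ = 11/40` for `SU(3)` (PROVED arithmetic; `γ₀² ≤ 1`): in the window after `K + M'` steps forces `40/33 ≤ L^{M'}`.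
[cite: Balaban1985UV3, (5) p.256] -/
theorem su3_fortyThirtyThirds_le_pow_of_betaTree_div_pow_le_11_40 {L : ℕ} (S : Scales L) (M' : ℕ)
    (h : betaTree (suGroupModel 3) S / (L : ℝ) ^ (S.K + M') ≤ 11 / 40) : (40 : ℝ) / 33 ≤ (L : ℝ) ^ M' := by
  have hγ : 0 < Dictionary.gammaSq S := Dictionary.gammaSq_pos S
  have hγ1 : Dictionary.gammaSq S ≤ 1 := Dictionary.gammaSq_le_one S
  have h1 : 40 / (33 * Dictionary.gammaSq S) ≤ (L : ℝ) ^ M' := (su3_betaTree_div_pow_le_11_40_iff S M').1 h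
  have h2 : (40 : ℝ) / 33 ≤ 40 / (33 * Dictionary.gammaSq S) := by
    rw [div_le_div_iff₀ (by norm_num : (0 : ℝ) < 33) (by positivity)]
    nlinarith
  exact h2.trans h1

/-- **The conjecture's counted task on the `SU(3)` `β_W = 33/40` row (PROVED arithmetic): still at least ONE block-RG step beyond Bałaban's
`K` at `O(1)` effective coupling (`M' ≠ 0`), for every admissible `γ₀`, at the row's ball for the record.** [cite: Balaban1985UV3, (5) p.256] -/
theorem su3_row_certifiedStar_crossover_pos {L : ℕ} (S : Scales L) (M' : ℕ)
    (h : betaTree (suGroupModel 3) S / (L : ℝ) ^ (S.K + M') ≤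
      (ballOfRobustBallFR 3 (11 / 500) (11 / 1000) 0 (11 / 40)).βstar) :
    M' ≠ 0 := by
  have h40 : (40 : ℝ) / 33 ≤ (L : ℝ) ^ M' := su3_fortyThirtyThirds_le_pow_of_betaTree_div_pow_le_11_40 S M' h
  rintro rfl
  norm_num at h40

end Summit.Ventures.YMGap.YM3IR

end
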